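import Summits.PneNP.PneNP.Theorems.ChebyshevTracialDesignTightNeighbourhoodRank
import Literature.Combinatorics.AssociationSchemes.CutMatchingRestriction
import HarnessLib

/-!
# Cell pnp-psdrank, route `ChebyshevTracialDesign`: the BICLIQUE SKELETON of the tight graph and LINK RIGIDITY
# (crux `TracialDecayExp20`, stmt-PneNP-19878)

Brick 71 (prover g13). Fine-scale combinatorics of the tight relation `cc(U,M) = |δ(U) ∩ M| = 1` between `t`-cuts `U` and perfect
matchings `M` of `K_n` — the first lemma of the 'structure theorem for orthogonal labellings' line (MEMO-15 §3(ii)/§7, MEMO-16 §1).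
* §1 (generic vertex type, `M` a perfect matching of `Ω`). THE `±1` LAW: inserting `a ∉ W` with `M`-partner `p` changes the crossing
  count by `+1` if `p ∉ W`, by `−1` if `p ∈ W`. Hence: if `M` SPLITS ALONG `W` (`crossCount W M = 0`, `W` a union of `M`-edges) every
  one-point extension / deletion of `W` is tight with `M`; conversely a tight `U` with crossing edge `{a,b}`, `a ∈ U`, has `M` splitting
  along `U − a` and along `U + b`, and `a`, `b` are unique. THE LINK IDENTITY (`tight_and_tight_iff`): for `a ≠ b` outside `W`,
      `cc(W + a, M) = 1 ∧ cc(W + b, M) = 1  ↔  cc(W, M) = 0 ∨ cc(W + a + b, M) = 0`;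
  for ADJACENT cuts (`|U ∩ U'| = t − 1`): `T(U) ∩ T(U') = Z(U ∩ U') ∪ Z(U ∪ U')`, `T` = tight neighbourhood, `Z(W) = {M : cc(W,M) = 0}`.
  So the tight graph is the union of the bicliques `Star⁺(W) × Z(W)` over even `(t−1)`-sets `W` (and of `Star⁻(W') × Z(W')` over even
  `(t+1)`-sets), every tight pair lying in exactly one of each; adjacent even sets have disjoint `Z`'s (`crossCount_swap_eq_two`).
* §2 the same in the kernel's currency `OddSet n`, `PMatch n`, `cc`.
* §3 tight psd rectangles `IsPsdRect X Y` of dimension `r`: BICLIQUE RIGIDITY `rank(Σ_{U ∈ Star^±(W)} X_U) + rank(Σ_{M ∈ Z(W)} Y_M) ≤ r`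
  and LINK RIGIDITY `rank(X_U + X_{U'}) + rank(Σ_{M ∈ Z(U∩U') ∪ Z(U∪U')} Y_M) ≤ r` for adjacent cuts: unless two adjacent cut ranges
  sit in a common small subspace, ALL matchings splitting along `U ∩ U'` or `U ∪ U'` live in the common orthogonal complement — the
  handle behind 'labels change at most `r − 1` times along a path of active cuts' (MEMO-15 §3(ii)).
[cite: Rothvoss2017, §2 (PDF pp. 5–6: `δ(U)`, `|δ(U) ∩ M|`, the pairs `Q_ℓ`)] [cite: BrietDadushPokutta2014, Thm. 6 (§3)]
Stature: support/instrument (elementary combinatorics + rank–nullity). WHAT THIS IS NOT: no value bound, no SNT for even sets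
(`Z(W)`-mass of homogeneous families), nothing on psd rank of P_PM(K_n), no P-vs-NP content.
-/

set_option linter.dupNamespace false -- `Summit.PneNP.PneNP.…`: summit = sub-problem (D-0017)

noncomputable section

namespace Summit.PneNP.PneNP.Theorems.ChebyshevTracialDesignTightLinks

open Finset Matrix Literature.Barriers.PneNP Literature.Combinatorics.Optimization
open Literature.Combinatorics.SimpleGraph.CycleSpace
open Literature.Combinatorics.AssociationSchemes.CutMatchingRestriction
open Summit.PneNP.PneNP.Theorems.ChebyshevTracialDesignTightNeighbourhoodRank

/-! ### §1 Generic vertex type: the `±1` law, splitting sets, the link identity -/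

section Generic

variable {α : Type*} [DecidableEq α]

/-- For a pair not containing `a`, crossing `insert a W` is the same as crossing `W`. -/
theorem crosses_insert_iff_of_not_mem {W : Finset α} {a : α} {e : Sym2 α} (ha : a ∉ e) :
    Crosses (insert a W) e ↔ Crosses W e := by
  induction e using Sym2.ind with
  | h x y =>
    rw [Sym2.mem_iff, not_or] at ha
    have hx : x ≠ a := fun h => ha.1 h.symm
    have hy : y ≠ a := fun h => ha.2 h.symm
    simp only [crosses_mk, mem_insert, hx, hy, false_or]

/-- The pair `{a, p}` with `a ∉ W`, `p ≠ a`: it crosses `W` iff `p ∈ W`, and it crosses `insert a W` iff `p ∉ W`. -/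
theorem crosses_mk_of_not_mem {W : Finset α} {a p : α} (ha : a ∉ W) (hpa : p ≠ a) :
    (Crosses W s(a, p) ↔ p ∈ W) ∧ (Crosses (insert a W) s(a, p) ↔ p ∉ W) := by
  refine ⟨?_, ?_⟩ <;> rw [crosses_mk]
  · exact ⟨fun h => h.elim (fun h => absurd h.1 ha) And.right, fun h => Or.inr ⟨ha, h⟩⟩
  · simp only [mem_insert, true_or, true_and, not_or, not_true_eq_false, false_and, or_false]
    exact ⟨fun h => h.2, fun h => ⟨hpa, h⟩⟩

/-- The common bookkeeping behind the `±1` law: split `M` into the edge `{a, p}` at `a` and the rest (which avoids `a`). -/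
private theorem crossCount_insert_aux {Ω W : Finset α} {M : Finset (Sym2 α)} (hM : IsPMOn Ω M) {a p : α}
    (hap : s(a, p) ∈ M) (ha : a ∉ W) :
    crossCount (insert a W) M = ((M.erase s(a, p)).filter (Crosses W)).card + (if p ∈ W then 0 else 1) ∧
      crossCount W M = ((M.erase s(a, p)).filter (Crosses W)).card + (if p ∈ W then 1 else 0) := by
  have hpa : p ≠ a := fun h => hM.not_isDiag hap (Sym2.mk_isDiag_iff.2 h.symm)
  have hMe : M = insert s(a, p) (M.erase s(a, p)) := (insert_erase hap).symm
  have hnot : s(a, p) ∉ M.erase s(a, p) := notMem_erase _ _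
  -- the rest of `M` avoids `a`
  have hrest : ∀ f ∈ M.erase s(a, p), a ∉ f := fun f hf haf =>
    (ne_of_mem_erase hf) (hM.unique (mem_of_mem_erase hf) hap haf (Sym2.mem_mk_left _ _))
  have hfilt : (M.erase s(a, p)).filter (Crosses (insert a W)) = (M.erase s(a, p)).filter (Crosses W) :=
    filter_congr fun f hf => crosses_insert_iff_of_not_mem (hrest f hf)
  obtain ⟨hcW, hcI⟩ := crosses_mk_of_not_mem ha hpa
  refine ⟨?_, ?_⟩
  · unfold crossCount
    rw [hMe, filter_insert, erase_insert hnot]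
    by_cases hp : p ∈ W
    · rw [if_neg (fun h => (hcI.1 h) hp), hfilt, if_pos hp, add_zero]
    · rw [if_pos (hcI.2 hp), card_insert_of_notMem (fun h => hnot (mem_of_mem_filter _ h)), hfilt, if_neg hp]
  · unfold crossCount
    conv_lhs => rw [hMe]
    rw [filter_insert]
    by_cases hp : p ∈ W
    · rw [if_pos (hcW.2 hp), card_insert_of_notMem (fun h => hnot (mem_of_mem_filter _ h)), if_pos hp]
    · rw [if_neg (fun h => hp (hcW.1 h)), if_neg hp, add_zero]

/-- **The `+1` law.** If the `M`-partner `p` of `a ∉ W` lies outside `W`, then `cc(W + a, M) = cc(W, M) + 1`.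
[cite: Rothvoss2017, §2 (PDF p. 5: `|δ(U) ∩ M|`)] -/
theorem crossCount_insert_of_not_mem {Ω W : Finset α} {M : Finset (Sym2 α)} (hM : IsPMOn Ω M) {a p : α}
    (hap : s(a, p) ∈ M) (ha : a ∉ W) (hp : p ∉ W) : crossCount (insert a W) M = crossCount W M + 1 := by
  obtain ⟨h1, h2⟩ := crossCount_insert_aux hM hap ha
  rw [h1, h2, if_neg hp, if_neg hp, add_zero]

/-- **The `−1` law.** If the `M`-partner `p` of `a ∉ W` lies inside `W`, then `cc(W + a, M) + 1 = cc(W, M)`.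
[cite: Rothvoss2017, §2 (PDF p. 5: `|δ(U) ∩ M|`)] -/
theorem crossCount_insert_of_mem {Ω W : Finset α} {M : Finset (Sym2 α)} (hM : IsPMOn Ω M) {a p : α}
    (hap : s(a, p) ∈ M) (ha : a ∉ W) (hp : p ∈ W) : crossCount (insert a W) M + 1 = crossCount W M := by
  obtain ⟨h1, h2⟩ := crossCount_insert_aux hM hap ha
  rw [h1, h2, if_pos hp, if_pos hp, add_zero]

/-- In either case the crossing counts of `W` and `W + a` differ by exactly one. -/
theorem crossCount_insert_dist {Ω W : Finset α} {M : Finset (Sym2 α)} (hM : IsPMOn Ω M) {a : α} (haΩ : a ∈ Ω)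
    (ha : a ∉ W) : crossCount (insert a W) M = crossCount W M + 1 ∨ crossCount (insert a W) M + 1 = crossCount W M := by
  obtain ⟨e, he, hae⟩ := hM.exists_mem haΩ
  have hap : s(a, Sym2.Mem.other hae) ∈ M := by rwa [Sym2.other_spec hae]
  by_cases hp : Sym2.Mem.other hae ∈ W
  · exact Or.inr (crossCount_insert_of_mem hM hap ha hp)
  · exact Or.inl (crossCount_insert_of_not_mem hM hap ha hp)

/-- **Splitting sets give tight extensions.** If `M` splits along `W` (`cc(W, M) = 0`: no edge of `M` leaves `W`) then every
one-point extension is tight: `cc(W + a, M) = 1` for `a ∈ Ω ∖ W`. [cite: Rothvoss2017, §2 (PDF p. 6: the tight pairs `Q_1`)] -/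
theorem crossCount_insert_eq_one_of_zero {Ω W : Finset α} {M : Finset (Sym2 α)} (hM : IsPMOn Ω M) {a : α} (haΩ : a ∈ Ω)
    (ha : a ∉ W) (h0 : crossCount W M = 0) : crossCount (insert a W) M = 1 := by
  rcases crossCount_insert_dist hM haΩ ha with h | h <;> omega

/-- … and so is every one-point deletion: `cc(W − a, M) = 1` for `a ∈ W` when `cc(W, M) = 0`.
[cite: Rothvoss2017, §2 (PDF p. 6: the tight pairs `Q_1`)] -/
theorem crossCount_erase_eq_one_of_zero {Ω W : Finset α} {M : Finset (Sym2 α)} (hM : IsPMOn Ω M) (hW : W ⊆ Ω) {a : α}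
    (ha : a ∈ W) (h0 : crossCount W M = 0) : crossCount (W.erase a) M = 1 := by
  have h := crossCount_insert_dist hM (hW ha) (W := W.erase a) (notMem_erase a W)
  rw [insert_erase ha] at h
  rcases h with h | h <;> omega

/-- **Tight sets come from splitting sets (deletion form).** If `cc(U, M) = 1` with crossing edge `{a, b}`, `a ∈ U`, `b ∉ U`,
then `M` splits along `U − a`. [cite: Rothvoss2017, §2 (PDF p. 6: the tight pairs `Q_1`)] -/
theorem crossCount_erase_eq_zero_of_one {Ω U : Finset α} {M : Finset (Sym2 α)} (hM : IsPMOn Ω M) {a b : α}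
    (hab : s(a, b) ∈ M) (ha : a ∈ U) (hb : b ∉ U) (h1 : crossCount U M = 1) : crossCount (U.erase a) M = 0 := by
  have h := crossCount_insert_of_not_mem hM hab (W := U.erase a) (notMem_erase a U) (fun h => hb (mem_of_mem_erase h))
  rw [insert_erase ha] at h
  omega

/-- **Tight sets come from splitting sets (insertion form).** If `cc(U, M) = 1` with crossing edge `{a, b}`, `a ∈ U`, `b ∉ U`,
then `M` splits along `U + b`. [cite: Rothvoss2017, §2 (PDF p. 6: the tight pairs `Q_1`)] -/
theorem crossCount_insert_eq_zero_of_one {Ω U : Finset α} {M : Finset (Sym2 α)} (hM : IsPMOn Ω M) {a b : α}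
    (hab : s(a, b) ∈ M) (ha : a ∈ U) (hb : b ∉ U) (h1 : crossCount U M = 1) : crossCount (insert b U) M = 0 := by
  have hba : s(b, a) ∈ M := by rw [Sym2.eq_swap]; exact hab
  have h := crossCount_insert_of_mem hM hba hb ha
  omega

/-- On a tight set the crossing edge exists: `cc(U, M) = 1` gives `{a, b} ∈ M` with `a ∈ U`, `b ∉ U`.
[cite: Rothvoss2017, §2 (PDF p. 6: the tight pairs `Q_1`)] -/
theorem exists_crossing_edge_of_one {U : Finset α} {M : Finset (Sym2 α)} (h1 : crossCount U M = 1) :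
    ∃ a b, s(a, b) ∈ M ∧ a ∈ U ∧ b ∉ U := by
  obtain ⟨e, he⟩ := card_eq_one.1 h1
  have heM : e ∈ M.filter (Crosses U) := by rw [he]; exact mem_singleton_self e
  obtain ⟨heM, hc⟩ := mem_filter.1 heM
  induction e using Sym2.ind with
  | h x y =>
    rcases (crosses_mk U x y).1 hc with ⟨hx, hy⟩ | ⟨hx, hy⟩
    · exact ⟨x, y, heM, hx, hy⟩
    · exact ⟨y, x, by rw [Sym2.eq_swap]; exact heM, hy, hx⟩

/-- **THE LINK IDENTITY.** For a perfect matching `M` of `Ω`, a set `W` and two distinct vertices `a, b ∈ Ω ∖ W`: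
`cc(W + a, M) = 1 ∧ cc(W + b, M) = 1 ↔ cc(W, M) = 0 ∨ cc(W + a + b, M) = 0`. In words: the tight neighbourhoods of two ADJACENT
cuts `U = W + a`, `U' = W + b` intersect exactly in the matchings splitting along `U ∩ U' = W` or along `U ∪ U' = W + a + b`.
[cite: Rothvoss2017, §2 (PDF p. 6: the tight pairs `Q_1`)] -/
theorem tight_and_tight_iff {Ω W : Finset α} {M : Finset (Sym2 α)} (hM : IsPMOn Ω M) {a b : α} (haΩ : a ∈ Ω) (hbΩ : b ∈ Ω)
    (ha : a ∉ W) (hb : b ∉ W) (hab : a ≠ b) :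
    crossCount (insert a W) M = 1 ∧ crossCount (insert b W) M = 1 ↔
      crossCount W M = 0 ∨ crossCount (insert a (insert b W)) M = 0 := by
  -- partners
  obtain ⟨e, he, hae⟩ := hM.exists_mem haΩ
  set p := Sym2.Mem.other hae with hpdef
  have hap : s(a, p) ∈ M := by rw [hpdef, Sym2.other_spec hae]; exact he
  obtain ⟨f, hf, hbf⟩ := hM.exists_mem hbΩ
  set q := Sym2.Mem.other hbf with hqdef
  have hbq : s(b, q) ∈ M := by rw [hqdef, Sym2.other_spec hbf]; exact hf
  have haW' : a ∉ insert b W := by rw [mem_insert, not_or]; exact ⟨hab, ha⟩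
  -- `p = b ↔ q = a` (the edge `{a,b}`)
  have hpq : p = b → q = a := by
    intro hpb
    rw [hpb] at hap
    have : s(b, q) = s(a, b) := hM.unique hbq hap (Sym2.mem_mk_left _ _) (Sym2.mem_mk_right _ _)
    rcases Sym2.eq_iff.1 this with ⟨h1, _⟩ | ⟨_, h2⟩
    · exact absurd h1 hab.symm
    · exact h2
  by_cases hpW : p ∈ W
  · -- `p ∈ W`, so `p ≠ b`
    have hA := crossCount_insert_of_mem hM hap ha hpW
    have hpW' : p ∈ insert b W := mem_insert_of_mem hpW
    have hAB := crossCount_insert_of_mem hM hap haW' hpW'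
    by_cases hqW : q ∈ W
    · have hB := crossCount_insert_of_mem hM hbq hb hqW
      constructor <;> intro h <;> omega
    · have hB := crossCount_insert_of_not_mem hM hbq hb hqW
      constructor <;> intro h <;> omega
  · have hA := crossCount_insert_of_not_mem hM hap ha hpW
    by_cases hqW : q ∈ W
    · have hB := crossCount_insert_of_mem hM hbq hb hqW
      -- then `p ≠ b` (else `q = a ∉ W`)
      have hpb : p ≠ b := fun h => ha (hpq h ▸ hqW)
      have hpW' : p ∉ insert b W := by rw [mem_insert, not_or]; exact ⟨hpb, hpW⟩
      have hAB := crossCount_insert_of_not_mem hM hap haW' hpW'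
      constructor <;> intro h <;> omega
    · have hB := crossCount_insert_of_not_mem hM hbq hb hqW
      by_cases hpb : p = b
      · have hpW' : p ∈ insert b W := by rw [hpb]; exact mem_insert_self _ _
        have hAB := crossCount_insert_of_mem hM hap haW' hpW'
        constructor <;> intro h <;> omega
      · have hpW' : p ∉ insert b W := by rw [mem_insert, not_or]; exact ⟨hpb, hpW⟩
        have hAB := crossCount_insert_of_not_mem hM hap haW' hpW'
        constructor <;> intro h <;> omega

/-- If `M` splits along `W` then no edge of `M` at a vertex outside `W` enters `W`. -/
theorem not_mem_of_crossCount_eq_zero {W : Finset α} {M : Finset (Sym2 α)} {a p : α} (hap : s(a, p) ∈ M) (ha : a ∉ W)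
    (h0 : crossCount W M = 0) : p ∉ W := by
  intro hp
  have hc : s(a, p) ∈ M.filter (Crosses W) := mem_filter.2 ⟨hap, (crosses_mk W a p).2 (Or.inr ⟨ha, hp⟩)⟩
  rw [crossCount, card_eq_zero] at h0
  exact notMem_empty _ (h0 ▸ hc)

/-- **Adjacent even sets are never split by the same matching**: if `M` splits along `W` then for `b ∈ W` and `a ∈ Ω ∖ W` the
swapped set `W − b + a` has `cc(W − b + a, M) = 2` (so `Z(W) ∩ Z(W') = ∅` whenever `|W △ W'| = 2`).
[cite: Rothvoss2017, §2 (PDF p. 5: `|δ(U) ∩ M|`)] -/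
theorem crossCount_swap_eq_two {Ω W : Finset α} {M : Finset (Sym2 α)} (hM : IsPMOn Ω M) (hW : W ⊆ Ω) {a b : α}
    (haΩ : a ∈ Ω) (ha : a ∉ W) (hb : b ∈ W) (h0 : crossCount W M = 0) : crossCount (insert a (W.erase b)) M = 2 := by
  have h1 : crossCount (W.erase b) M = 1 := crossCount_erase_eq_one_of_zero hM hW hb h0
  obtain ⟨e, he, hae⟩ := hM.exists_mem haΩ
  have hap : s(a, Sym2.Mem.other hae) ∈ M := by rw [Sym2.other_spec hae]; exact he
  have hp : Sym2.Mem.other hae ∉ W := not_mem_of_crossCount_eq_zero hap ha h0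
  have h := crossCount_insert_of_not_mem hM hap (W := W.erase b) (fun h => ha (mem_of_mem_erase h))
    (fun h => hp (mem_of_mem_erase h))
  omega

end Generic

/-! ### §2 The kernel's currency: `t`-cuts of `K_n`, `cc`, the bicliques `Star^±(W) × Z(W)` -/

section Cuts

variable {n : ℕ}

/-- A one-element difference: if `W ⊆ U` and `|U| = |W| + 1` then `U = W + a` for some `a ∉ W`. -/
theorem eq_insert_of_subset_of_card {W U : Finset (Fin n)} (hWU : W ⊆ U) (hcard : U.card = W.card + 1) :
    ∃ a, a ∉ W ∧ U = insert a W := by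
  have h1 : (U \ W).card = 1 := by have := card_sdiff_add_card_eq_card hWU; omega
  obtain ⟨a, ha⟩ := card_eq_one.1 h1
  have haUW : a ∈ U \ W := by rw [ha]; exact mem_singleton_self a
  refine ⟨a, (mem_sdiff.1 haUW).2, ?_⟩
  rw [← sdiff_union_of_subset hWU, ha]
  rfl

/-- **Upper biclique.** If `M` splits along `W` (`crossCount W M = 0`) then every `t`-cut `U ⊇ W` with `|U| = |W| + 1` is tight with
`M`: `Star⁺(W) × Z(W)` is a complete bipartite subgraph of the tight graph. [cite: Rothvoss2017, §2 (PDF p. 6: the tight pairs `Q_1`)] -/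
theorem cc_eq_one_of_upper {W : Finset (Fin n)} {M : PMatch n} (h0 : crossCount W M.1 = 0) {U : OddSet n} (hWU : W ⊆ U.1)
    (hcard : U.1.card = W.card + 1) : cc U M = 1 := by
  obtain ⟨a, ha, hU⟩ := eq_insert_of_subset_of_card hWU hcard
  rw [cc_eq_crossCount, hU]
  exact crossCount_insert_eq_one_of_zero M.2 (mem_univ a) ha h0

/-- **Lower biclique.** If `M` splits along `W'` then every `t`-cut `U ⊆ W'` with `|W'| = |U| + 1` is tight with `M`:
`Star⁻(W') × Z(W')` is a complete bipartite subgraph of the tight graph. [cite: Rothvoss2017, §2 (PDF p. 6: the tight pairs `Q_1`)] -/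
theorem cc_eq_one_of_lower {W' : Finset (Fin n)} {M : PMatch n} (h0 : crossCount W' M.1 = 0) {U : OddSet n} (hUW : U.1 ⊆ W')
    (hcard : W'.card = U.1.card + 1) : cc U M = 1 := by
  obtain ⟨b, hb, hW'⟩ := eq_insert_of_subset_of_card hUW hcard
  have hU : U.1 = W'.erase b := by rw [hW', erase_insert hb]
  rw [cc_eq_crossCount, hU]
  exact crossCount_erase_eq_one_of_zero M.2 (subset_univ _) (by rw [hW']; exact mem_insert_self b _) h0

/-- **Every tight pair lies in an upper and a lower biclique**: if `cc(U, M) = 1` then the crossing edge `{a, b}` (`a ∈ U`, `b ∉ U`)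
has `M` splitting along `U − a` and along `U + b`. [cite: Rothvoss2017, §2 (PDF p. 6: the tight pairs `Q_1`)] -/
theorem exists_splits_of_cc_eq_one {U : OddSet n} {M : PMatch n} (h1 : cc U M = 1) :
    ∃ a b, s(a, b) ∈ M.1 ∧ a ∈ U.1 ∧ b ∉ U.1 ∧ crossCount (U.1.erase a) M.1 = 0 ∧ crossCount (insert b U.1) M.1 = 0 := by
  rw [cc_eq_crossCount] at h1
  obtain ⟨a, b, hab, ha, hb⟩ := exists_crossing_edge_of_one h1
  exact ⟨a, b, hab, ha, hb, crossCount_erase_eq_zero_of_one M.2 hab ha hb h1, crossCount_insert_eq_zero_of_one M.2 hab ha hb h1⟩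

/-- **… and in exactly one of each**: the vertex `a ∈ U` with `M` splitting along `U − a` is unique (two candidates `a ≠ a'` would
give adjacent even sets `U − a`, `U − a'` both split by `M`, contradicting `crossCount_swap_eq_two`). -/
theorem splits_below_unique {U : OddSet n} {M : PMatch n} {a a' : Fin n} (ha : a ∈ U.1) (ha' : a' ∈ U.1)
    (h0 : crossCount (U.1.erase a) M.1 = 0) (h0' : crossCount (U.1.erase a') M.1 = 0) : a = a' := by
  by_contra hne
  have ha'W : a' ∈ U.1.erase a := mem_erase.2 ⟨fun h => hne h.symm, ha'⟩
  have h2 := crossCount_swap_eq_two M.2 (subset_univ _) (mem_univ a) (notMem_erase a U.1) ha'W h0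
  have hset : insert a ((U.1.erase a).erase a') = U.1.erase a' := by
    rw [erase_right_comm, insert_erase (mem_erase.2 ⟨hne, ha⟩)]
  rw [hset, h0'] at h2
  exact absurd h2 (by norm_num)

/-- Dually, the vertex `b ∉ U` with `M` splitting along `U + b` is unique. -/
theorem splits_above_unique {U : OddSet n} {M : PMatch n} {b b' : Fin n} (hb : b ∉ U.1) (hb' : b' ∉ U.1)
    (h0 : crossCount (insert b U.1) M.1 = 0) (h0' : crossCount (insert b' U.1) M.1 = 0) : b = b' := by
  by_contra hne
  have hb'W : b' ∉ insert b U.1 := by rw [mem_insert, not_or]; exact ⟨fun h => hne h.symm, hb'⟩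
  have h2 := crossCount_swap_eq_two M.2 (subset_univ _) (mem_univ b') hb'W (mem_insert_self b U.1) h0
  have hset : insert b' ((insert b U.1).erase b) = insert b' U.1 := by rw [erase_insert hb]
  rw [hset, h0'] at h2
  exact absurd h2 (by norm_num)

/-- **THE LINK IDENTITY for adjacent `t`-cuts.** For `U = W + a`, `U' = W + b` (`a ≠ b` outside `W`) and every perfect matching `M`:
`cc(U,M) = 1 ∧ cc(U',M) = 1 ↔ cc(W, M) = 0 ∨ cc(W + a + b, M) = 0`, i.e. `T(U) ∩ T(U') = Z(U ∩ U') ∪ Z(U ∪ U')`.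
[cite: Rothvoss2017, §2 (PDF p. 6: the tight pairs `Q_1`)] -/
theorem cc_and_cc_iff {W : Finset (Fin n)} {a b : Fin n} (ha : a ∉ W) (hb : b ∉ W) (hab : a ≠ b) {U U' : OddSet n}
    (hU : U.1 = insert a W) (hU' : U'.1 = insert b W) (M : PMatch n) :
    cc U M = 1 ∧ cc U' M = 1 ↔ crossCount W M.1 = 0 ∨ crossCount (insert a (insert b W)) M.1 = 0 := by
  rw [cc_eq_crossCount, cc_eq_crossCount, hU, hU']
  exact tight_and_tight_iff M.2 (mem_univ a) (mem_univ b) ha hb hab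

/-- Adjacent cuts in coordinates: if `|U ∩ U'| + 1 = |U| = |U'|` then `U = W + a`, `U' = W + b` with `W = U ∩ U'`, `a ≠ b` outside `W`,
and `U ∪ U' = W + a + b`. -/
theorem adjacent_coords {U U' : Finset (Fin n)} (h : (U ∩ U').card + 1 = U.card) (h' : (U ∩ U').card + 1 = U'.card) :
    ∃ a b, a ∉ U ∩ U' ∧ b ∉ U ∩ U' ∧ a ≠ b ∧ U = insert a (U ∩ U') ∧ U' = insert b (U ∩ U') ∧
      U ∪ U' = insert a (insert b (U ∩ U')) := by
  set W := U ∩ U' with hW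
  clear_value W
  obtain ⟨a, ha, hUa⟩ := eq_insert_of_subset_of_card (show W ⊆ U by rw [hW]; exact inter_subset_left) h.symm
  obtain ⟨b, hb, hUb⟩ := eq_insert_of_subset_of_card (show W ⊆ U' by rw [hW]; exact inter_subset_right) h'.symm
  have hab : a ≠ b := by
    rintro rfl
    have haU : a ∈ U := by rw [hUa]; exact mem_insert_self _ _
    have haU' : a ∈ U' := by rw [hUb]; exact mem_insert_self _ _
    exact ha (hW ▸ mem_inter.2 ⟨haU, haU'⟩)
  refine ⟨a, b, ha, hb, hab, hUa, hUb, ?_⟩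
  subst hUa hUb
  ext x
  simp only [mem_union, mem_insert]
  tauto

/-- **The link identity for adjacent `t`-cuts, coordinate-free form**: if `|U ∩ U'| + 1 = |U| = |U'|` then for every `M`,
`cc(U,M) = 1 ∧ cc(U',M) = 1 ↔ cc(U ∩ U', M) = 0 ∨ cc(U ∪ U', M) = 0`. [cite: Rothvoss2017, §2 (PDF p. 6: the tight pairs `Q_1`)] -/
theorem cc_and_cc_iff_of_adjacent {U U' : OddSet n} (h : (U.1 ∩ U'.1).card + 1 = U.1.card) (h' : (U.1 ∩ U'.1).card + 1 = U'.1.card)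
    (M : PMatch n) : cc U M = 1 ∧ cc U' M = 1 ↔ crossCount (U.1 ∩ U'.1) M.1 = 0 ∨ crossCount (U.1 ∪ U'.1) M.1 = 0 := by
  obtain ⟨a, b, ha, hb, hab, hUa, hUb, hun⟩ := adjacent_coords h h'
  rw [hun]
  exact cc_and_cc_iff ha hb hab hUa hUb M

end Cuts

/-! ### §3 Tight psd rectangles: biclique rigidity and link rigidity -/

section Psd

variable {n r : ℕ} {X : OddSet n → Matrix (Fin r) (Fin r) ℝ} {Y : PMatch n → Matrix (Fin r) (Fin r) ℝ}

/-- **Biclique rigidity (upper).** For a tight-orthogonal psd rectangle and any vertex set `W`: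
`rank(Σ_{U ∈ Star⁺(W)} X_U) + rank(Σ_{M ∈ Z(W)} Y_M) ≤ r` — the ranges of all cut operators on the one-point extensions of `W`
and of all matching operators on the matchings splitting along `W` span complementary-dimensional subspaces.
[cite: BrietDadushPokutta2014, Thm. 6 (§3)] [cite: Rothvoss2017, §2 (PDF p. 6)] -/
theorem rank_upperStar_add_rank_split_le (hXY : IsPsdRect X Y) (W : Finset (Fin n)) :
    (∑ U ∈ univ.filter (fun U : OddSet n => W ⊆ U.1 ∧ U.1.card = W.card + 1), X U).rank +
      (∑ M ∈ univ.filter (fun M : PMatch n => crossCount W M.1 = 0), Y M).rank ≤ r :=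
  rank_sum_add_rank_sum_le hXY _ _ fun _ hU _ hM =>
    cc_eq_one_of_upper (mem_filter.1 hM).2 (mem_filter.1 hU).2.1 (mem_filter.1 hU).2.2

/-- **Biclique rigidity (lower).** `rank(Σ_{U ∈ Star⁻(W')} X_U) + rank(Σ_{M ∈ Z(W')} Y_M) ≤ r`.
[cite: BrietDadushPokutta2014, Thm. 6 (§3)] [cite: Rothvoss2017, §2 (PDF p. 6)] -/
theorem rank_lowerStar_add_rank_split_le (hXY : IsPsdRect X Y) (W' : Finset (Fin n)) :
    (∑ U ∈ univ.filter (fun U : OddSet n => U.1 ⊆ W' ∧ W'.card = U.1.card + 1), X U).rank +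
      (∑ M ∈ univ.filter (fun M : PMatch n => crossCount W' M.1 = 0), Y M).rank ≤ r :=
  rank_sum_add_rank_sum_le hXY _ _ fun _ hU _ hM =>
    cc_eq_one_of_lower (mem_filter.1 hM).2 (mem_filter.1 hU).2.1 (mem_filter.1 hU).2.2

/-- **LINK RIGIDITY.** For adjacent `t`-cuts `U = W + a`, `U' = W + b` of a tight-orthogonal psd rectangle of dimension `r`:
`rank(X_U + X_{U'}) + rank(Σ_{M ∈ Z(W) ∪ Z(W+a+b)} Y_M) ≤ r`. For psd operators `range(X_U + X_{U'}) = range X_U + range X_{U'}`, so every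
matching splitting along `U ∩ U'` or along `U ∪ U'` has its range inside `(range X_U + range X_{U'})^⊥`: if the two cut ranges are not
contained in a common subspace of dimension `d`, all these matchings live in codimension `> d`.
[cite: BrietDadushPokutta2014, Thm. 6 (§3)] [cite: Rothvoss2017, §2 (PDF p. 6)] -/
theorem rank_add_add_rank_link_le (hXY : IsPsdRect X Y) {W : Finset (Fin n)} {a b : Fin n} (ha : a ∉ W) (hb : b ∉ W)
    (hab : a ≠ b) {U U' : OddSet n} (hU : U.1 = insert a W) (hU' : U'.1 = insert b W) :
    (X U + X U').rank +
      (∑ M ∈ univ.filter (fun M : PMatch n => crossCount W M.1 = 0 ∨ crossCount (insert a (insert b W)) M.1 = 0), Y M).rank ≤ r := by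
  refine rank_add_rank_le_of_mul_eq_zero _ _ ?_
  rw [mul_sum]
  refine sum_eq_zero fun M hM => ?_
  obtain ⟨h1, h1'⟩ := (cc_and_cc_iff ha hb hab hU hU' M).2 (mem_filter.1 hM).2
  rw [add_mul, hXY.2.2 U M h1, hXY.2.2 U' M h1', add_zero]

/-- Link rigidity, coordinate-free form: `|U ∩ U'| + 1 = |U| = |U'|` ⇒ `rank(X_U + X_{U'}) + rank(Σ_{M ∈ Z(U∩U') ∪ Z(U∪U')} Y_M) ≤ r`.
[cite: BrietDadushPokutta2014, Thm. 6 (§3)] [cite: Rothvoss2017, §2 (PDF p. 6)] -/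
theorem rank_add_add_rank_link_le_of_adjacent (hXY : IsPsdRect X Y) {U U' : OddSet n}
    (h : (U.1 ∩ U'.1).card + 1 = U.1.card) (h' : (U.1 ∩ U'.1).card + 1 = U'.1.card) :
    (X U + X U').rank +
      (∑ M ∈ univ.filter (fun M : PMatch n => crossCount (U.1 ∩ U'.1) M.1 = 0 ∨ crossCount (U.1 ∪ U'.1) M.1 = 0), Y M).rank ≤ r := by
  refine rank_add_rank_le_of_mul_eq_zero _ _ ?_
  rw [mul_sum]
  refine sum_eq_zero fun M hM => ?_
  obtain ⟨h1, h1'⟩ := (cc_and_cc_iff_of_adjacent h h' M).2 (mem_filter.1 hM).2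
  rw [add_mul, hXY.2.2 U M h1, hXY.2.2 U' M h1', add_zero]

/-- **A matching splitting along `W` kills every cut operator above `W`**: `X_U Y_M = 0` for `U ∈ Star⁺(W)`, `M ∈ Z(W)` — so, for
instance, an ACTIVE matching (`Y_M` of full rank... or merely `Y_M v ≠ 0`) splitting along `W` forces `X_U v' ⊥`-constraints on the whole
upper star at once. [cite: BrietDadushPokutta2014, Thm. 6 (§3)] -/
theorem mul_eq_zero_of_upper (hXY : IsPsdRect X Y) {W : Finset (Fin n)} {M : PMatch n} (h0 : crossCount W M.1 = 0) {U : OddSet n}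
    (hWU : W ⊆ U.1) (hcard : U.1.card = W.card + 1) : X U * Y M = 0 :=
  hXY.2.2 U M (cc_eq_one_of_upper h0 hWU hcard)

/-- Dually for the lower star. [cite: BrietDadushPokutta2014, Thm. 6 (§3)] -/
theorem mul_eq_zero_of_lower (hXY : IsPsdRect X Y) {W' : Finset (Fin n)} {M : PMatch n} (h0 : crossCount W' M.1 = 0) {U : OddSet n}
    (hUW : U.1 ⊆ W') (hcard : W'.card = U.1.card + 1) : X U * Y M = 0 :=
  hXY.2.2 U M (cc_eq_one_of_lower h0 hUW hcard)

end Psd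

end Summit.PneNP.PneNP.Theorems.ChebyshevTracialDesignTightLinks
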